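import Literature.MathematicalPhysics.QuantumFieldTheory.Balaban1983to89.B6Ineq2138KLevelSkeletonV1

/-!
# `Balaban1983to89.B6LastLegsDivNormSuppKLevelV1` — T. Bałaban, *Propagators and renormalization transformations for lattice gauge theories. II*,
# Commun. Math. Phys. **96** (1984) 223–250 [Balaban1984PropagatorsII], (2.134)–(2.135) × (2.141) p. 247: THE LAST LEGS
# `R∇*_ν = Σ_{□,□′} K_{□,□′}G_{□′}h_{□′}∇*_ν` ON THE CENSUS HÖLDER CLASS OF (2.138)∕(2.139), GLUED OVER THE PAIRS OF CUBES FROM THE PER-PAIR LEGS — the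
# interface between the c3 and the c4 lanes of node N03 (cell pub-ymgap; seats dag-n03-b, dag-n02-b, dag-p1 = n03-a)

statement-level skeleton of published theorems with citation tags; proofs where landed; nothing here is a claim about the Yang–Mills mass gap

PRINT (p. 247 [PDF 25]): *"|(K_{□,□′}G_{□′}h_{□′}J)(x)| ≤ O(M⁻¹)e^{−½δ₂d(y,y′)}|J| (2.134) for x ∈ Δ(y), supp J ⊂ Δ(y′), y, y′ ∈ 𝔅, and this together with (2.91)
implies |(RJ)(x)| ≤ O(M⁻¹)e^{−½δ₂d(y,y′)}|J| (2.135)"*; *"G = G₀(I − R)⁻¹ = Σ G₀Rⁿ … (2.141) and the series above is convergent in the norms appearing in the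
inequalities (2.136)–(2.140)"*; p. 239 [PDF 17]: *"Δ_aG₀ = I − Σ_{□,□′} K_{□,□′}G_{□′}h_{□′} = I − R (2.91)"*.

CITATION HEADER (lean-in-tree rule) — WHAT IS REPRODUCED.  Cell pub-ymgap, seat `pub-ymgap-dag-p1` = n03-a (KNIT-BY-NAME for node N03; D-0062 ∕ R429;
offered on the cell bus 2026-08-25 [DAGP1-G2-OFFER-GLUE], unclaimed by the c3∕c4 seats).  ONE theorem, **`lastLegs_kLevel_of_divLegs`**: the step (2.134) ⇒
(2.135) «in the norms of (2.138)» as a NAMED interface — from the PER-PAIR legs on the census Hölder class (hypothesis `hlegs`, CHARACTER FOR CHARACTER the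
binder of dag-n03-b's `B6Ineq2138KLevelSkeletonV1.ineq2138_kLevel_census_of_legs`, whose producer is dag-n03-b's `B6Ineq2134DivNormSuppKLevelV1.divLegs_kLevel`)
to the GLUED last legs `rOp … * ∇*_μ` (conclusion, CHARACTER FOR CHARACTER the binder `hlast` of dag-n02-b's `B6Prop26HolderGrad2KLevelV1.holderGrad2_pair_kLevel_census`,
the (2.139) pair walk).  Proof = dag-n03-b's own localisation inside `ineq2138_kLevel_skeleton`, made a theorem: each pair term is output-localised in `□̃`
(`B6Prop26KLevelSkeletonV2.outLoc_kFam_big` ← `B6CubeMoutV1.outLoc_Ml_hB'`) and kills the admissible inputs off `□′⁺` (`B6Ineq2138KLevelSkeletonV1.inKill_hB_DVa`)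
— `B6RandomWalkInputNormChain.hasMajorantA_localise` — then the bounded overlap `3·9^{d+1}` of the `□̃` (`B6Cover236QbigOverlapV1.card_filter_mem_QbigT_le`,
`hNov_SbigT_of_QbigT`) glues the double sum (`hasMajorantA_sum_pairs_overlap`, `rOp = Σ_{□,□′}` by `Finset.sum_mul`); witnesses `σ₀ := σ_L`,
`M₀ := max M_L 1`, `N′ := 0`, `θ ↦ (3·9^{d+1})²·θ`, and `|c′|/L^{j(y′)} = (L^{j(y′)}·|c′|⁻¹)⁻¹`.
THEOREMS ONLY (no `def`, no `def … : Prop`); standard axioms; imports dag-n03-b's skeleton only.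

HONEST SCOPE.  Pure bookkeeping between two sibling interfaces — no estimate; the legs themselves are dag-n03-b's (L1)–(L3) and dag-p1's (L2b).  Setting and census
sub-case (`supp J ⊂ Δ(y′)`, GAPS G-B6-2138-SUPP) as in the imported files.  A T1 slot interface, NOT a node discharge; NOT summit progress.  Seat `pub-ymgap-dag-p1`
(g2), 2026-08-25.
-/

open scoped BigOperators
open Finset

namespace Literature.MathematicalPhysics.QuantumFieldTheory.Balaban1983to89.B6LastLegsDivNormSuppKLevelV1

open LatticeFieldCalculus
open B6MultiLevelBoxOperator (N0)
open B6MultiLevelTorusOperator (TDomains)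
open B6Cover236MultiLevelBlocks (cubes)
open B6Geom246MultiLevelTorus (geomT)
open B8Ineq192MultiLevelTorus (lenT_pos)
open B6RandomWalkInputNorm (HasMajorantA NormSupp hasMajorantA_mono normSupp_nonneg)
open B6RandomWalkInputNormChain (hasMajorantA_localise hasMajorantA_sum_pairs_overlap)
open B6Prop26Gluing (mulOp OutLoc outLoc_mul ind ind_nonneg ind_of_mem ind_of_not_mem)
open B6Eq291Generator (kFam rOp)
open B6Ineq2133TwoScaleV1 (onFun)
open B6GlobalChartV1 (PV domT blkV1)
open B6SectAOperatorsV1 (dE dsE RE BondIdx)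
open B6LapLegKLevelV1 (DVa)
open B6Partition118KLevelTorusCentral (one_le_of_four_le)
open B6Prop26KLevelSkeletonV1 (hB zB ST)
open B6Prop26KLevelSkeletonV2 (SbigT ST_subset_SbigT hNov_SbigT_of_QbigT outLoc_kFam_big)
open B6CubeWindowV1 (Placed Gl Ml Pl GlobalBand band_le one_le_of_eight_le four_le_of_five_le)
open B6CubeMoutV1 (outLoc_Ml_hB')
open B6Cover236QbigOverlapV1 (card_filter_mem_QbigT_le)
open B6Prop26KLevelAssemblyV1 (distT_nonneg)
open B6HolderNormV1 (holderV1 supNormV1)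
open B6Ineq2138KLevelSkeletonV1 (inKill_hB_DVa)

noncomputable section

variable {d ℓ : ℕ} {hd : 1 ≤ d + 1} {hL : Odd (ℓ + 1) ∧ 1 < ℓ + 1} {b₀ b₁ : ℝ}

/-- an exponential kernel with a smaller rate dominates. [cite: Balaban1984PropagatorsII, (2.141) p.247, bookkeeping] -/
private theorem exp_le_exp_of_rate {ρ ρ' t : ℝ} (h : ρ' ≤ ρ) (ht : 0 ≤ t) : Real.exp (-(ρ * t)) ≤ Real.exp (-(ρ' * t)) :=
  Real.exp_le_exp.mpr (neg_le_neg (mul_le_mul_of_nonneg_right h ht))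

open Classical in
/-- **THE LAST LEGS `R∇*_ν = Σ_{□,□′} K_{□,□′}G_{□′}h_{□′}∇*_ν` ON THE CENSUS HÖLDER CLASS, GLUED FROM THE PER-PAIR LEGS** — the interface between seat
dag-n03-b's per-pair family (the `hlegs` binder of `B6Ineq2138KLevelSkeletonV1.ineq2138_kLevel_census_of_legs`, discharged by its
`B6Ineq2134DivNormSuppKLevelV1.divLegs_kLevel`) and seat dag-n02-b's glued input (the `hlast` binder of `B6Prop26HolderGrad2KLevelV1.holderGrad2_pair_kLevel_census`,
the (2.139) pair walk): each pair term is localised in output to `□̃` (`outLoc_kFam_big` ← `outLoc_Ml_hB'`) and kills the admissible inputs off `□′⁺`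
(`inKill_hB_DVa`), then the bounded overlap `3·9^{d+1}` of the `□̃` glues the double sum (`hasMajorantA_sum_pairs_overlap`) — dag-n03-b's own steps inside
`ineq2138_kLevel_skeleton`, made a named theorem; rate `σ₀ := σ_L`, thresholds `M₀ := max M_L 1`, `N′ := 0`, `θ ↦ (3·9^{d+1})²·θ`, and
`|c′|/L^{j(y′)} = (L^{j(y′)}·|c′|⁻¹)⁻¹`. [cite: Balaban1984PropagatorsII, (2.134)–(2.135) p.247, (2.141) p.247, (2.91) p.239, p.235] -/
theorem lastLegs_kLevel_of_divLegs (hb₀ : 0 < b₀) (hb₁ : b₀ ≤ b₁)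
    (hlegs : ∃ σL : ℝ, 0 < σL ∧ ∀ σ : ℝ, 0 < σ → σ ≤ σL → ∃ ML : ℝ, ∀ ε : ℝ, 0 < ε → ε < 1 → ∃ θ : ℝ, 0 ≤ θ ∧
      ∀ (m K : ℕ) {Mh k R : ℕ} {P' : Fin (d + 1) → ℕ}
        (hN : ∀ μ, N0 ℓ Mh k P' μ = (PV d ℓ m K hd hL).sitesPerDir 0) (D : TDomains d ℓ Mh k P' R) (hk : k ≤ m + K) (_ : 2 ≤ k)
        {a : ℕ} (hMha : Mh = (ℓ + 1) ^ a) (hM8 : 8 ≤ Mh) (_ : 2 * (ℓ + 1) ^ 2 ≤ R) (hP5 : ∀ μ, 5 ≤ P' μ) (_ : 4 ≤ ℓ)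
        (hpl : ∀ c : ↥(cubes D.toDomains), Placed ℓ k P' c.1) (_ : ML ≤ ((ℓ : ℝ) + 1) * Mh)
        {cf : ℝ} (_ : cf ≠ 0) {w : BondIdx (domT hN D hk) → ℝ} (_ : ∀ i, 0 < w i) (_ : GlobalBand b₀ b₁ cf w)
        (ν : Fin (d + 1)) (c c' : ↥(cubes D.toDomains)),
        HasMajorantA (g := geomT D) (blkV1 hN D)
          (NormSupp (g := geomT D) (blkV1 hN D) (fun y' => ({y'} : Set (geomT D).Site)) (fun _ J => holderV1 hN D ε J + supNormV1 J))
          (kFam (onFun (dE (P := PV d ℓ m K hd hL) cf ∘ₗ (LinearMap.id - RE (domT hN D hk) cf) ∘ₗ dsE cf))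
              (fun c => mulOp (hB hN D c)) (fun c => mulOp (zB hN D (one_le_of_eight_le hM8) (four_le_of_five_le hP5) c))
              (fun c => Ml hN hk (one_le_of_eight_le hM8) (four_le_of_five_le hP5) hMha c (band_le (d := d) (ℓ := ℓ) hb₀ hb₁) (hpl c) w cf)
              (fun c => Pl hN hk (one_le_of_eight_le hM8) (four_le_of_five_le hP5) hMha c (band_le (d := d) (ℓ := ℓ) hb₀ hb₁) (hpl c) w cf) c c' *
            Gl hN hk (one_le_of_eight_le hM8) (four_le_of_five_le hP5) hMha c' (band_le (d := d) (ℓ := ℓ) hb₀ hb₁) (hpl c') w cf *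
            mulOp (hB hN D c') * DVa (P := PV d ℓ m K hd hL) ν cf)
          (fun y y' => θ * (|cf| / (geomT D).len y') * Real.exp (-(σ * (geomT D).dist y y')))) :
    ∃ (σ₀ M₀ : ℝ) (N' : ℕ), 0 < σ₀ ∧ 0 < M₀ ∧ ∀ (ε' : ℝ), 0 < ε' → ε' < 1 → ∃ θ : ℝ, 0 ≤ θ ∧
      ∀ (m K : ℕ) {Mh k R : ℕ} {P' : Fin (d + 1) → ℕ}
        (hN : ∀ μ, N0 ℓ Mh k P' μ = (PV d ℓ m K hd hL).sitesPerDir 0) (D : TDomains d ℓ Mh k P' R) (hk : k ≤ m + K) (_ : 2 ≤ k)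
        {a : ℕ} (hMha : Mh = (ℓ + 1) ^ a) (hM8 : 8 ≤ Mh) (_ : 2 * (ℓ + 1) ^ 2 ≤ R) (hP5 : ∀ μ, 5 ≤ P' μ) (_ : 4 ≤ ℓ)
        (hpl : ∀ c : ↥(cubes D.toDomains), Placed ℓ k P' c.1) (_ : M₀ ≤ ((ℓ : ℝ) + 1) * Mh) (_ : N' + 1 ≤ R * ((ℓ + 1) * Mh))
        {cf : ℝ} (hcf : cf ≠ 0) {w : BondIdx (domT hN D hk) → ℝ} (hw : ∀ i, 0 < w i) (_ : GlobalBand b₀ b₁ cf w) (μ : Fin (d + 1)),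
        HasMajorantA (g := geomT D) (blkV1 hN D)
          (NormSupp (g := geomT D) (blkV1 hN D) (fun y' => ({y'} : Set (geomT D).Site)) (fun _ J => holderV1 hN D ε' J + supNormV1 J))
          (rOp Finset.univ (onFun (dE (P := PV d ℓ m K hd hL) cf ∘ₗ (LinearMap.id - RE (domT hN D hk) cf) ∘ₗ dsE cf))
              (fun c => mulOp (hB hN D c)) (fun c => mulOp (zB hN D (one_le_of_eight_le hM8) (four_le_of_five_le hP5) c))
              (fun c => Gl hN hk (one_le_of_eight_le hM8) (four_le_of_five_le hP5) hMha c (band_le (d := d) (ℓ := ℓ) hb₀ hb₁) (hpl c) w cf)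
              (fun c => Ml hN hk (one_le_of_eight_le hM8) (four_le_of_five_le hP5) hMha c (band_le (d := d) (ℓ := ℓ) hb₀ hb₁) (hpl c) w cf)
              (fun c => Pl hN hk (one_le_of_eight_le hM8) (four_le_of_five_le hP5) hMha c (band_le (d := d) (ℓ := ℓ) hb₀ hb₁) (hpl c) w cf) *
            DVa (P := PV d ℓ m K hd hL) μ cf)
          (fun y y' => θ * ((geomT D).len y' * |cf|⁻¹)⁻¹ * Real.exp (-(σ₀ * (geomT D).dist y y'))) := by
  obtain ⟨σL, hσL, HL⟩ := hlegs
  obtain ⟨ML, HL2⟩ := HL σL hσL le_rfl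
  refine ⟨σL, max ML 1, 0, hσL, lt_max_of_lt_right one_pos, fun ε hε0 hε1 => ?_⟩
  obtain ⟨θ, hθ, hleg⟩ := HL2 ε hε0 hε1
  refine ⟨(((3 * 9 ^ (d + 1) : ℕ) : ℝ)) ^ 2 * θ, by positivity, ?_⟩
  intro m K Mh k R P' hN D hk hk2 a hMha hM8 hR2 hP5 hℓ hpl hM0 _hN0 cf hcf w hw hwb ν
  have hMh1 : 1 ≤ Mh := one_le_of_eight_le hM8
  have hMh : 2 ≤ Mh := le_trans (by norm_num) hM8
  have hP4 : ∀ μ, 4 ≤ P' μ := four_le_of_five_le hP5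
  have hR : 2 * (ℓ + 1) ≤ R := le_trans (by nlinarith : 2 * (ℓ + 1) ≤ 2 * (ℓ + 1) ^ 2) hR2
  have hML : ML ≤ ((ℓ : ℝ) + 1) * Mh := (le_max_left _ _).trans hM0
  have hdnn : ∀ y y' : (geomT D).Site, 0 ≤ (geomT D).dist y y' := distT_nonneg
  have hadm0 : ∀ (J : PBond (PV d ℓ m K hd hL) 0 → ℝ) (y' : (geomT D).Site) (B : ℝ),
      NormSupp (g := geomT D) (blkV1 hN D) (fun y' => ({y'} : Set (geomT D).Site)) (fun _ J => holderV1 hN D ε J + supNormV1 J) J y' B → 0 ≤ B :=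
    fun _ _ _ hμ => hμ.nonneg
  -- abbreviations
  set Dg := onFun (dE (P := PV d ℓ m K hd hL) cf ∘ₗ (LinearMap.id - RE (domT hN D hk) cf) ∘ₗ dsE cf) with hDg
  set hBs : ↥(cubes D.toDomains) → Module.End ℝ (PBond (PV d ℓ m K hd hL) 0 → ℝ) := fun c => mulOp (hB hN D c) with hhBs
  set zBs : ↥(cubes D.toDomains) → Module.End ℝ (PBond (PV d ℓ m K hd hL) 0 → ℝ) := fun c => mulOp (zB hN D hMh1 hP4 c) with hzBs
  set Gls : ↥(cubes D.toDomains) → Module.End ℝ (PBond (PV d ℓ m K hd hL) 0 → ℝ) :=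
    fun c => Gl hN hk hMh1 hP4 hMha c (band_le (d := d) (ℓ := ℓ) hb₀ hb₁) (hpl c) w cf with hGls
  set Mls : ↥(cubes D.toDomains) → Module.End ℝ (PBond (PV d ℓ m K hd hL) 0 → ℝ) :=
    fun c => Ml hN hk hMh1 hP4 hMha c (band_le (d := d) (ℓ := ℓ) hb₀ hb₁) (hpl c) w cf with hMls
  set Pls : ↥(cubes D.toDomains) → Module.End ℝ (PBond (PV d ℓ m K hd hL) 0 → ℝ) :=
    fun c => Pl hN hk hMh1 hP4 hMha c (band_le (d := d) (ℓ := ℓ) hb₀ hb₁) (hpl c) w cf with hPls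
  set Dν := DVa (P := PV d ℓ m K hd hL) ν cf with hDν
  set Qw : (geomT D).Site → ℝ := fun y' => ((geomT D).len y' * |cf|⁻¹)⁻¹ with hQw
  have hcf0 : 0 < |cf| := abs_pos.2 hcf
  have hQw0 : ∀ y', 0 ≤ Qw y' := fun y' => by have := lenT_pos D y'; rw [hQw]; positivity
  have hQeq : ∀ y', |cf| / (geomT D).len y' = Qw y' := fun y' => by
    have := lenT_pos D y'; rw [hQw]; field_simp
  -- the double sum
  have hRsum : rOp Finset.univ Dg hBs zBs Gls Mls Pls * Dν =
      ∑ c ∈ (Finset.univ : Finset ↥(cubes D.toDomains)), ∑ c' ∈ (Finset.univ : Finset ↥(cubes D.toDomains)),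
        kFam Dg hBs zBs Mls Pls c c' * Gls c' * hBs c' * Dν := by
    unfold rOp; rw [Finset.sum_mul]; refine Finset.sum_congr rfl fun c _ => ?_; rw [Finset.sum_mul]
  have hMout : ∀ c, OutLoc (g := geomT D) (blkV1 hN D) (Mls c * mulOp (hB hN D c)) (SbigT D hMh1 hP4 c) :=
    fun c => outLoc_Ml_hB' hN hk hMh1 hP4 hMha c (band_le (d := d) (ℓ := ℓ) hb₀ hb₁) hM8 hR2 hP5 (hpl c) w cf
  -- the per-pair legs, localised
  have hpairs : ∀ c ∈ (Finset.univ : Finset ↥(cubes D.toDomains)), ∀ c' ∈ (Finset.univ : Finset ↥(cubes D.toDomains)),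
      HasMajorantA (g := geomT D) (blkV1 hN D)
        (NormSupp (g := geomT D) (blkV1 hN D) (fun y' => ({y'} : Set (geomT D).Site)) (fun _ J => holderV1 hN D ε J + supNormV1 J))
        (kFam Dg hBs zBs Mls Pls c c' * Gls c' * hBs c' * Dν)
        (fun y y' => ind (SbigT D hMh1 hP4 c) y * ind (SbigT D hMh1 hP4 c') y' * (θ * Qw y' * Real.exp (-(σL * (geomT D).dist y y')))) := by
    intro c _ c' _
    have h2134D := hleg m K hN D hk hk2 hMha hM8 hR2 hP5 hℓ hpl hML hcf hw hwb ν c c'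
    have hout : OutLoc (g := geomT D) (blkV1 hN D) (kFam Dg hBs zBs Mls Pls c c' * Gls c' * hBs c' * Dν) (SbigT D hMh1 hP4 c) :=
      outLoc_mul _ (outLoc_mul _ (outLoc_kFam_big hN D hMh hR hMh1 hP4 Dg Gls Mls Pls hMout c c') _) _
    have hin := inKill_hB_DVa hN D (hMh1 := hMh1) hP4 hMh hM8 hR hP5 c' cf ν (kFam Dg hBs zBs Mls Pls c c' * Gls c')
      (N := fun _ J => holderV1 hN D ε J + supNormV1 J)
    have hloc := hasMajorantA_localise (g := geomT D) (blkV1 hN D) h2134D hout hin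
    refine hasMajorantA_mono (g := geomT D) (blkV1 hN D) hloc hadm0 fun y y' => ?_
    have hK : 0 ≤ θ * Qw y' * Real.exp (-(σL * (geomT D).dist y y')) := mul_nonneg (mul_nonneg hθ (hQw0 y')) (Real.exp_nonneg _)
    have h1 : ind (ST D hMh1 hP4 c') y' ≤ ind (SbigT D hMh1 hP4 c') y' := by
      by_cases hy : y' ∈ ST D hMh1 hP4 c'
      · rw [ind_of_mem hy, ind_of_mem (ST_subset_SbigT D hMh1 hP4 c' hy)]
      · rw [ind_of_not_mem hy]; exact ind_nonneg _ _
    have h2 : θ * (|cf| / (geomT D).len y') * Real.exp (-(σL * (geomT D).dist y y')) = θ * Qw y' * Real.exp (-(σL * (geomT D).dist y y')) := by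
      rw [hQeq]
    rw [h2]
    exact mul_le_mul_of_nonneg_right (mul_le_mul_of_nonneg_left h1 (ind_nonneg _ _)) hK
  -- gluing over the pairs with the overlap `3·9^{d+1}` of the `□̃`
  rw [hRsum]
  have h := hasMajorantA_sum_pairs_overlap (g := geomT D) (blkV1 hN D) Finset.univ (fun c => SbigT D hMh1 hP4 c)
    (fun c c' => kFam Dg hBs zBs Mls Pls c c' * Gls c' * hBs c' * Dν) (fun y y' => θ * Qw y' * Real.exp (-(σL * (geomT D).dist y y')))
    (fun y y' => mul_nonneg (mul_nonneg hθ (hQw0 y')) (Real.exp_nonneg _)) hadm0 hpairs (3 * 9 ^ (d + 1))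
    (hNov_SbigT_of_QbigT D hMh1 hP4 (fun y => card_filter_mem_QbigT_le D hL hMh hR2 hMh1 hP4 y))
  refine hasMajorantA_mono (g := geomT D) (blkV1 hN D) h hadm0 fun y y' => le_of_eq ?_
  rw [hQw]; push_cast; ring

end

end Literature.MathematicalPhysics.QuantumFieldTheory.Balaban1983to89.B6LastLegsDivNormSuppKLevelV1
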